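import Literature.Algebra.Homology.StaircaseBounds
import Literature.Algebra.Homology.StaircaseExact
import Literature.AlgebraicGeometry.Crystalline.DeRhamComplexSheaf
import HarnessLib

/-!
# Staircase reductions of the de Rham complex and X. Hu's complexes `p^{r,M}_{r,N} Ω•`

Specialisation of the abstract staircase constructions of `Algebra/Homology/StaircaseComplexes` to
the algebraic de Rham complex `Ω• = Ω•_{X/A}` (`Crystalline/DeRhamComplexSheaf.algebraicDeRhamComplex`)
of an `A`-scheme `X` and an integer `q` (in the application: `A = W(k)`, `X = 𝒳` a smooth formal
lift, `q = p`):

* `deRhamReduction X q r N = Ω• / q^{(r-•)N}` — the complex of abelian sheaves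
  `[𝒪/q^{rN} → Ω¹/q^{(r-1)N} → ⋯ → Ω^{r-1}/q^{N} → 0 → ⋯]` (terms `j ≥ r` are quotients by
  `q⁰ = 1`, hence zero objects); for `X = 𝒳` smooth over `W(k)` its `j`-th term is
  `Ωʲ_{X_{(r-j)N}/W_{(r-j)N}}` (de Rham sheaves of the thickening `X_m = 𝒳 ⊗ W/pᵐ` pushed to `𝒳`),
  with the reduction maps `deRhamReductionMap` (`N ≤ N'`);
* `huComplex X q r M N = q^{(r-•)M} (Ω• / q^{(r-•)N})` — **X. Hu's complex**
  `p^{r,M}_{r,N}Ω• = [p^{rM}𝒪_{X_{rN}} → p^{(r-1)M}Ω¹_{X_{(r-1)N}} → ⋯ → p^{M}Ω^{r-1}_{X_N}]`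
  (X. Hu, arXiv:2507.12458, Def. 8.2), the staircase image subcomplex; `huComplex X q r 1 N` is
  Bloch–Esnault–Kerz's `p(r)Ω•_{X_N}` (arXiv:1203.2776, §2, (2.2)); with the inclusions
  `huComplexLE` (`M' ≤ M`: `p^{r,M}_{r,N} ⊆ p^{r,M'}_{r,N}`) and the reductions `huComplexReduce`
  (`N ≤ N'`), the two maps of Hu's three-term sequences, and the SHORT EXACTNESS of those
  sequences `0 → p^{r,M}_{r,N} → p^{r,M'}_{r,N} → p^{r,M'}_{r,M} → 0` for `M' ≤ M ≤ N` (`hu_shortExact`,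
  from `Algebra/Homology/StaircaseExact.staircase_shortExact` — no torsion hypothesis needed);
* `huComplexInt X q r M N` — the `ℤ`-indexed extension by zero (for hypercohomology,
  `Crystalline/SheafHypercohomology`), strictly concentrated in degrees `[0, r-1]`
  (`isZero_huComplex_X`, instances `IsStrictlyGE 0` / `IsStrictlyLE (r-1)`).

Sources: X. Hu, *On the K-theory of p-adic formal schemes* (arXiv:2507.12458, 2025), Def. 8.1–8.3;
S. Bloch, H. Esnault, M. Kerz, *p-adic deformation of algebraic cycle classes*, Invent. Math. 195
(2014) (arXiv:1203.2776), §2. The constructions are [folklore] homological algebra on cited objects;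
no statement of those papers is asserted here.
Everything is proved; no named facts. NOT here: the identification of the terms with the de Rham
sheaves of the thickenings `X_m` as schemes (`Motives.WittScheme.thickening`) and with
`Ωʲ_{X_{(r-j)(N-M)}}` (needs `q`-torsion-freeness of `Ωʲ_{𝒳/W}`), hypercohomology `ℍ^{2r}(X_1, p^{r,M}_{r,N}Ω•)` (apply `Crystalline/SheafHypercohomology` to
the `ℤ`-extension), Hu's `K₀`-lifting criterion (a named fact to be stated on these carriers).
-/

noncomputable section

namespace Literature.AlgebraicGeometry.Crystalline

open CategoryTheory CategoryTheory.Limits _root_.AlgebraicGeometry _root_.TopologicalSpace Literature.Algebra.Homology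

universe u

variable {A : Type u} [CommRing A] (X : Over (Spec (CommRingCat.of A))) (q : ℤ)

/-- The staircase exponent function `j ↦ (r - j) · N` is antitone. [folklore] -/
theorem antitone_staircase (r N : ℕ) : Antitone fun j : ℕ ↦ (r - j) * N :=
  fun _ _ hab ↦ Nat.mul_le_mul_right N (Nat.sub_le_sub_left hab r)

/-- `(r - j) · N ≤ (r - j) · N'` for `N ≤ N'`. [folklore] -/
theorem staircase_le_staircase (r : ℕ) {N N' : ℕ} (h : N ≤ N') :
    (fun j : ℕ ↦ (r - j) * N) ≤ fun j ↦ (r - j) * N' :=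
  fun j ↦ Nat.mul_le_mul_left (r - j) h

/-- **The staircase reduction `Ω• / q^{(r-•)N}`** of the algebraic de Rham complex of `X`:
`[𝒪/q^{rN} → Ω¹/q^{(r-1)N} → ⋯ → Ω^{r-1}/q^{N} → 0 → ⋯]`, a cochain complex of abelian sheaves on
`X` (degreewise cokernels of `q^{(r-j)N}`). For a smooth formal lift `𝒳/W(k)` and `q = p` its terms
are the de Rham sheaves `Ωʲ_{X_{(r-j)N}}` of the thickenings. (Hu, arXiv:2507.12458, §8; BEK
arXiv:1203.2776, §2.) [folklore] -/
abbrev deRhamReduction (r N : ℕ) :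
    CochainComplex (Sheaf (Opens.grothendieckTopology X.left) AddCommGrpCat.{u}) ℕ :=
  powQuotient (algebraicDeRhamComplex X) q (antitone_staircase r N)

/-- The projection `Ω• ⟶ Ω• / q^{(r-•)N}`. [folklore] -/
abbrev deRhamReductionπ (r N : ℕ) : algebraicDeRhamComplex X ⟶ deRhamReduction X q r N :=
  powQuotientπ (algebraicDeRhamComplex X) q (antitone_staircase r N)

/-- The reduction map `Ω• / q^{(r-•)N'} ⟶ Ω• / q^{(r-•)N}` for `N ≤ N'` (on terms:
`Ωʲ_{X_{(r-j)N'}} → Ωʲ_{X_{(r-j)N}}`). [folklore] -/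
abbrev deRhamReductionMap (r : ℕ) {N N' : ℕ} (h : N ≤ N') :
    deRhamReduction X q r N' ⟶ deRhamReduction X q r N :=
  powQuotientMap (algebraicDeRhamComplex X) q (antitone_staircase r N) (antitone_staircase r N')
    (staircase_le_staircase r h)

/-- The reduction maps are compatible with the projections. [folklore] -/
theorem deRhamReductionπ_comp_deRhamReductionMap (r : ℕ) {N N' : ℕ} (h : N ≤ N') :
    deRhamReductionπ X q r N' ≫ deRhamReductionMap X q r h = deRhamReductionπ X q r N :=
  powQuotientπ_comp_powQuotientMap _ _ _ _ _

/-- **X. Hu's complex `p^{r,M}_{r,N}Ω•`** (with `q` for `p`):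
`[q^{rM}(𝒪/q^{rN}) → q^{(r-1)M}(Ω¹/q^{(r-1)N}) → ⋯ → q^{M}(Ω^{r-1}/q^{N})]`, the staircase image
subcomplex `q^{(r-•)M}` of the staircase reduction `Ω• / q^{(r-•)N}`; for `M = 1` this is
Bloch–Esnault–Kerz's `p(r)Ω•_{X_N}`. (X. Hu, arXiv:2507.12458, Def. 8.2; BEK arXiv:1203.2776, (2.2).)
[folklore] -/
abbrev huComplex (r M N : ℕ) :
    CochainComplex (Sheaf (Opens.grothendieckTopology X.left) AddCommGrpCat.{u}) ℕ :=
  powImage (deRhamReduction X q r N) q (antitone_staircase r M)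

/-- The inclusion `p^{r,M}_{r,N}Ω• ⟶ Ω• / q^{(r-•)N}`. [folklore] -/
abbrev huComplexι (r M N : ℕ) : huComplex X q r M N ⟶ deRhamReduction X q r N :=
  powImageι (deRhamReduction X q r N) q (antitone_staircase r M)

/-- **The inclusion `p^{r,M}_{r,N}Ω• ⊆ p^{r,M'}_{r,N}Ω•` for `M' ≤ M`** (first map of Hu's three-term
sequence, arXiv:2507.12458 Def. 8.2 / Lemma 8.4). [folklore] -/
abbrev huComplexLE (r : ℕ) {M M' : ℕ} (h : M' ≤ M) (N : ℕ) :
    huComplex X q r M N ⟶ huComplex X q r M' N :=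
  powImageLE (deRhamReduction X q r N) q (antitone_staircase r M') (antitone_staircase r M)
    (staircase_le_staircase r h)

/-- The inclusions `huComplexLE` are compatible with the inclusions into `Ω• / q^{(r-•)N}`.
[folklore] -/
theorem huComplexLE_comp_huComplexι (r : ℕ) {M M' : ℕ} (h : M' ≤ M) (N : ℕ) :
    huComplexLE X q r h N ≫ huComplexι X q r M' N = huComplexι X q r M N :=
  powImageLE_comp_powImageι _ _ _ _ _

/-- **The reduction `p^{r,M}_{r,N'}Ω• ⟶ p^{r,M}_{r,N}Ω•` for `N ≤ N'`** (push-forward of the staircase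
images along the reduction map; second map of Hu's three-term sequence when `N = M_Hu`).
[folklore] -/
abbrev huComplexReduce (r M : ℕ) {N N' : ℕ} (h : N ≤ N') :
    huComplex X q r M N' ⟶ huComplex X q r M N :=
  powImageMap (deRhamReduction X q r N') q (antitone_staircase r M) (deRhamReductionMap X q r h)

/-- The reductions `huComplexReduce` are compatible with the inclusions and the reduction maps of
`Ω• / q^{(r-•)N}`. [folklore] -/
theorem huComplexReduce_comp_huComplexι (r M : ℕ) {N N' : ℕ} (h : N ≤ N') :
    huComplexReduce X q r M h ≫ huComplexι X q r M N =
      huComplexι X q r M N' ≫ deRhamReductionMap X q r h :=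
  powImageMap_comp_powImageι _ _ _ _

/-- Hu's complex has no terms in degrees `j ≥ r` (they are images inside `Ωʲ/q⁰ = 0`). [folklore] -/
theorem isZero_huComplex_X (r M N : ℕ) {j : ℕ} (hj : r ≤ j) : IsZero ((huComplex X q r M N).X j) :=
  isZero_powImage_X _ q _ (isZero_powQuotient_X_of_le _ q _ hj)

/-- Hu's complex `p^{r,M}_{r,N}Ω•` as a `ℤ`-indexed cochain complex of abelian sheaves (extension by
zero in negative degrees, Mathlib's `HomologicalComplex.extend` along `ComplexShape.embeddingUpNat`),
the shape on which hypercohomology `ℍⁿ` (`Crystalline/SheafHypercohomology`) is taken. [folklore] -/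
abbrev huComplexInt (r M N : ℕ) :
    CochainComplex (Sheaf (Opens.grothendieckTopology X.left) AddCommGrpCat.{u}) ℤ :=
  (huComplex X q r M N).extend ComplexShape.embeddingUpNat

/-- `p^{r,M}_{r,N}Ω•` (as a `ℤ`-complex) is strictly concentrated in degrees `≥ 0`. [folklore] -/
instance isStrictlyGE_huComplexInt (r M N : ℕ) : (huComplexInt X q r M N).IsStrictlyGE 0 :=
  inferInstance

/-- `p^{r,M}_{r,N}Ω•` (as a `ℤ`-complex) is strictly concentrated in degrees `≤ r - 1`; with
cohomological dimension `≤ d` this bounds its hypercohomology to degrees `≤ (r - 1) + d`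
(`Crystalline.sheafHypercohomology_eq_zero`). [folklore] -/
instance isStrictlyLE_huComplexInt (r M N : ℕ) :
    (huComplexInt X q r M N).IsStrictlyLE ((r : ℤ) - 1) :=
  isStrictlyLE_extend_powImage_powQuotient _ q _ _

/-- The reduction `p^{r,M}_{r,N'}Ω• ⟶ p^{r,M}_{r,N}Ω•` (`N ≤ N'`) on the `ℤ`-indexed complexes (Mathlib's
`HomologicalComplex.extendMap`), the map inducing Hu's reduction maps on hypercohomology.
[folklore] -/
abbrev huComplexIntReduce (r M : ℕ) {N N' : ℕ} (h : N ≤ N') :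
    huComplexInt X q r M N' ⟶ huComplexInt X q r M N :=
  HomologicalComplex.extendMap (huComplexReduce X q r M h) ComplexShape.embeddingUpNat

/-- The inclusion `p^{r,M}_{r,N}Ω• ⟶ p^{r,M'}_{r,N}Ω•` (`M' ≤ M`) on the `ℤ`-indexed complexes.
[folklore] -/
abbrev huComplexIntLE (r : ℕ) {M M' : ℕ} (h : M' ≤ M) (N : ℕ) :
    huComplexInt X q r M N ⟶ huComplexInt X q r M' N :=
  HomologicalComplex.extendMap (huComplexLE X q r h N) ComplexShape.embeddingUpNat

/-- **X. Hu's three-term sequence** `p^{r,M}_{r,N}Ω• ⟶ p^{r,M'}_{r,N}Ω• ⟶ p^{r,M'}_{r,M}Ω•` for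
`M' ≤ M ≤ N` (inclusion, then reduction), as a short complex of cochain complexes of abelian sheaves.
(X. Hu, arXiv:2507.12458, §8.) [folklore] -/
abbrev huShortComplex (r : ℕ) {M M' N : ℕ} (hM : M' ≤ M) (hN : M ≤ N) :
    ShortComplex (CochainComplex (Sheaf (Opens.grothendieckTopology X.left) AddCommGrpCat.{u}) ℕ) :=
  staircaseShortComplex (algebraicDeRhamComplex X) q (antitone_staircase r M')
    (antitone_staircase r M) (antitone_staircase r N) (staircase_le_staircase r hM)
    (staircase_le_staircase r hN)

/-- The objects of Hu's three-term sequence are the Hu complexes `p^{r,M}_{r,N}`, `p^{r,M'}_{r,N}`,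
`p^{r,M'}_{r,M}` (definitionally). [folklore] -/
theorem huShortComplex_X (r : ℕ) {M M' N : ℕ} (hM : M' ≤ M) (hN : M ≤ N) :
    (huShortComplex X q r hM hN).X₁ = huComplex X q r M N ∧
      (huShortComplex X q r hM hN).X₂ = huComplex X q r M' N ∧
        (huShortComplex X q r hM hN).X₃ = huComplex X q r M' M :=
  ⟨rfl, rfl, rfl⟩

/-- **Hu's three-term sequences are short exact**:
`0 → p^{r,M}_{r,N}Ω• → p^{r,M'}_{r,N}Ω• → p^{r,M'}_{r,M}Ω• → 0` for `M' ≤ M ≤ N` (for every `A`-scheme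
`X` and integer `q`; no torsion hypothesis). (X. Hu, arXiv:2507.12458, §8, used in Prop. 11.1.)
[folklore] -/
theorem hu_shortExact (r : ℕ) {M M' N : ℕ} (hM : M' ≤ M) (hN : M ≤ N) :
    (huShortComplex X q r hM hN).ShortExact :=
  staircase_shortExact _ _ _ _ _ _ _

end Literature.AlgebraicGeometry.Crystalline

end
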